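import Summits.CriticalPhenomena.SAWScalingLimit.Theses.SAWRenewalTightness
import Summits.CriticalPhenomena.SAWScalingLimit.Theorems.SAWRenewalTightnessEventualTightConfinementRatioMono
import HarnessLib

/-!
# Crux `ConfinementPositivity` (stmt-CriticalPhenomena-17587), line `Sketch` (card sign-universality),
# stub T2 `stub_standardPairReduction`: the standard-pair statement implies the crux

Registered stub `stub_standardPairReduction` of the lead skeleton
`Cruxes/ConfinementPositivity/Lines/Sketch.lean` (hypothesis `hT` of its glue `ConfinementPositivity_of`):

  SPC (standard-pair confinement) → body of `SAWRenewalTightness.ConfinementPositivity`.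

Here SPC says: for every Dobrushin domain `D = (Ω; a, b)` with an endpoint approximation, a radius `L`
with `closure Ω ⊆ B(0, L/2)` and a plug radius `0 < r ≤ |a - b|/8`, the critical SAW of the SOCKETED DISC
`Ω ∪ (B(0,L) ∖ (B̄(a,r) ∪ B̄(b,r)))` from `a_δ` to `b_δ` is, with probability `≥ c > 0` for `δ ∈ (0, δ₀]`,
an `Ω_δ`-walk all of whose vertices lie in the doubled socket balls `B(a,2r) ∪ B(b,2r)` or in a finite,
`δ`-independent complex of closed rectangles `Complex.Rectangle z w ⊆ Ω`.

## Proof (outer standardisation `T2 = T2a ∘ T2b`)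

* T2b (`standardPair_socketedDisc_of_standardPair`, event inclusion): SPC implies the ONE-domain normal
  form SDC of the crux, "the critical SAW of the socketed disc of `D` is a `D_δ`-walk with probability
  `≥ c`" (drop the box-complex constraint).
* T2a (`standardPair_confinementPositivity_of_socketedDisc`): SDC implies the crux.  For a crux pair
  `(D' ⊆ D, d)` take `L = 2R` with `closure D ⊆ B(0, R)` and `r = min (d/2) (|a-b|/8)`.  The sockets of
  `D` inside `B̄(a,r) ∪ B̄(b,r)` lie in `D'`, so the two socketed discs COINCIDE
  (`standardPair_socketedDisc_eq`): `Ω_{L,r}(D') = Ω_{L,r}(D) ⊇ D ⊇ D'`.  For `δ` below the socket-nesting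
  threshold of `D ⊆ Ω(D)` (`exists_meshDomain_subset_socket`, landed in `…ShellCrossingBoundSocketNesting`)
  and the Jordan-nesting threshold of `D' ⊆ D` (`JordanDomain.exists_forall_meshDomain_subset`), every
  `D'_δ`-walk is a `D_δ`-walk and every `D_δ`-walk is an `Ω(D')_δ`-walk with the same support
  (`exists_domainSAW_of_meshDomain_subset`), and the confinement probability is ANTITONE in the outer
  domain by the exact restriction identity (`ConfinementMono.law_setOf_exists_support_eq_anti`,
  `…EventualTightConfinementRatioMono`).  Hence `P_D[γ is a D'_δ-walk] ≥ P_{Ω(D')}[γ is a D'_δ-walk] ≥ c`.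

Folklore lattice bookkeeping over landed tree lemmas; no new named fact, no `def`.
-/

noncomputable section

open MeasureTheory Set Metric Filter Topology
open scoped BigOperators ENNReal Topology
open Literature.Probability.RandomPlanarGeometry Literature.Probability.RandomPlanarGeometry.SAW
open Literature.Probability.LatticeModels

namespace Summit.CriticalPhenomena.SAWScalingLimit.Theorems

/-! ### T2b: SPC → SDC (event inclusion) -/

/-- **T2b.** The standard-pair event ("`γ` is a `D_δ`-walk living in the socket balls and the box
complex") is contained in the crux event ("`γ` is a `D_δ`-walk"), so SPC implies the one-domain normal
form SDC. [folklore] -/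
theorem standardPair_socketedDisc_of_standardPair
    (h : ∀ (D : DobrushinDomain) (a b : ℝ → Site 2), SAW.IsEndpointApprox D a b →
      ∀ (L r : ℝ), closure D.carrier ⊆ Metric.ball (0 : ℂ) (L / 2) → 0 < r →
        8 * r ≤ dist (D.pt 0) (D.pt 1) →
        ∃ (B : Finset (ℂ × ℂ)) (c δ₀ : ℝ), (∀ p ∈ B, Complex.Rectangle p.1 p.2 ⊆ D.carrier) ∧
          0 < c ∧ 0 < δ₀ ∧ ∀ δ ∈ Set.Ioc (0 : ℝ) δ₀,
          ENNReal.ofReal c ≤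
            SAW.law (D.carrier ∪ (Metric.ball (0 : ℂ) L \
                (Metric.closedBall (D.pt 0) r ∪ Metric.closedBall (D.pt 1) r))) δ (a δ) (b δ)
              {γ | ∃ γ' : SAW.DomainSAW D.carrier δ (a δ) (b δ),
                γ'.walk.support = γ.walk.support ∧
                ∀ v ∈ γ'.walk.support,
                  meshPoint δ v ∈ Metric.ball (D.pt 0) (2 * r) ∪ Metric.ball (D.pt 1) (2 * r) ∨
                  ∃ p ∈ B, meshPoint δ v ∈ Complex.Rectangle p.1 p.2}) :
    ∀ (D : DobrushinDomain) (a b : ℝ → Site 2), SAW.IsEndpointApprox D a b →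
      ∀ (L r : ℝ), closure D.carrier ⊆ Metric.ball (0 : ℂ) (L / 2) → 0 < r →
        8 * r ≤ dist (D.pt 0) (D.pt 1) →
        ∃ c δ₀ : ℝ, 0 < c ∧ 0 < δ₀ ∧ ∀ δ ∈ Set.Ioc (0 : ℝ) δ₀,
          ENNReal.ofReal c ≤
            SAW.law (D.carrier ∪ (Metric.ball (0 : ℂ) L \
                (Metric.closedBall (D.pt 0) r ∪ Metric.closedBall (D.pt 1) r))) δ (a δ) (b δ)
              {γ | ∃ γ' : SAW.DomainSAW D.carrier δ (a δ) (b δ),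
                γ'.walk.support = γ.walk.support} := by
  intro D a b hab L r hL hr hd
  obtain ⟨B, c, δ₀, -, hc, hδ₀, hconf⟩ := h D a b hab L r hL hr hd
  refine ⟨c, δ₀, hc, hδ₀, fun δ hδ => (hconf δ hδ).trans (measure_mono ?_)⟩
  rintro γ ⟨γ', hγ', -⟩
  exact ⟨γ', hγ'⟩

/-! ### T2a: SDC → the crux (outer standardisation) -/

/-- The socketed discs of a crux pair coincide: if `D' ⊆ D ⊆ B(0, L)` and
`D ∩ (B̄(a,r) ∪ B̄(b,r)) ⊆ D'`, then `D ∪ (B(0,L) ∖ plugs) = D' ∪ (B(0,L) ∖ plugs)`. [folklore] -/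
theorem standardPair_socketedDisc_eq {D D' : Set ℂ} {a b : ℂ} {L r : ℝ} (hsub : D' ⊆ D)
    (hDL : D ⊆ ball (0 : ℂ) L) (hsock : D ∩ (closedBall a r ∪ closedBall b r) ⊆ D') :
    D ∪ (ball (0 : ℂ) L \ (closedBall a r ∪ closedBall b r)) =
      D' ∪ (ball (0 : ℂ) L \ (closedBall a r ∪ closedBall b r)) := by
  refine Subset.antisymm (union_subset (fun z hz => ?_) subset_union_right)
    (union_subset (hsub.trans subset_union_left) subset_union_right)
  by_cases h : z ∈ closedBall a r ∪ closedBall b r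
  · exact Or.inl (hsock ⟨hz, h⟩)
  · exact Or.inr ⟨hDL hz, h⟩

/-- **T2a.** The one-domain normal form SDC ("the critical SAW of the socketed disc of `D` is a
`D_δ`-walk with probability `≥ c`") implies the crux: `P_D[γ is a D'_δ-walk] ≥
P_{Ω(D')}[γ is a D'_δ-walk]` because `Ω(D') = Ω(D) ⊇ D` with nested discrete domains for small `δ`
(socket nesting, Jordan nesting) and the confinement probability is antitone in the outer domain
(exact restriction identity). [folklore] -/
theorem standardPair_confinementPositivity_of_socketedDisc
    (h : ∀ (D : DobrushinDomain) (a b : ℝ → Site 2), SAW.IsEndpointApprox D a b →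
      ∀ (L r : ℝ), closure D.carrier ⊆ Metric.ball (0 : ℂ) (L / 2) → 0 < r →
        8 * r ≤ dist (D.pt 0) (D.pt 1) →
        ∃ c δ₀ : ℝ, 0 < c ∧ 0 < δ₀ ∧ ∀ δ ∈ Set.Ioc (0 : ℝ) δ₀,
          ENNReal.ofReal c ≤
            SAW.law (D.carrier ∪ (Metric.ball (0 : ℂ) L \
                (Metric.closedBall (D.pt 0) r ∪ Metric.closedBall (D.pt 1) r))) δ (a δ) (b δ)
              {γ | ∃ γ' : SAW.DomainSAW D.carrier δ (a δ) (b δ),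
                γ'.walk.support = γ.walk.support}) :
    ∀ (D D' : DobrushinDomain) (a b : ℝ → Site 2) (d : ℝ), 0 < d → D'.carrier ⊆ D.carrier →
      D'.pt 0 = D.pt 0 → D'.pt 1 = D.pt 1 →
      D.carrier ∩ (Metric.ball (D.pt 0) d ∪ Metric.ball (D.pt 1) d) ⊆ D'.carrier →
      SAW.IsEndpointApprox D' a b → ∃ c δ₀ : ℝ, 0 < c ∧ 0 < δ₀ ∧ ∀ δ ∈ Set.Ioc (0 : ℝ) δ₀,
        ENNReal.ofReal c ≤ SAW.law D.carrier δ (a δ) (b δ)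
          {γ | ∃ γ' : SAW.DomainSAW D'.carrier δ (a δ) (b δ), γ'.walk.support = γ.walk.support} := by
  intro D D' a b d hd hsub h0 h1 hsock hab
  -- the disc radius `L = 2R`
  obtain ⟨R, hR⟩ := D.isBounded.closure.subset_ball (0 : ℂ)
  have hRpos : 0 < R := pos_of_mem_ball (hR (subset_closure D.nonempty.some_mem))
  have hL : closure D.carrier ⊆ ball (0 : ℂ) (2 * R / 2) := by
    rw [show (2 * R / 2 : ℝ) = R by ring]
    exact hR
  have hL' : closure D'.carrier ⊆ ball (0 : ℂ) (2 * R / 2) := (closure_mono hsub).trans hL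
  have hDL : D.carrier ⊆ ball (0 : ℂ) (2 * R) :=
    subset_closure.trans (hR.trans (ball_subset_ball (by linarith)))
  -- the plug radius `r`
  have hne : D.pt 0 ≠ D.pt 1 := D.pt_injective.ne (by decide)
  set r : ℝ := min (d / 2) (dist (D.pt 0) (D.pt 1) / 8) with hr_def
  have hr : 0 < r := lt_min (half_pos hd) (div_pos (dist_pos.2 hne) (by norm_num))
  have hrd : r < d := (min_le_left _ _).trans_lt (half_lt_self hd)
  have hd8 : 8 * r ≤ dist (D.pt 0) (D.pt 1) := by
    have := min_le_right (d / 2) (dist (D.pt 0) (D.pt 1) / 8)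
    rw [← hr_def] at this
    linarith
  have hd8' : 8 * r ≤ dist (D'.pt 0) (D'.pt 1) := by rwa [h0, h1]
  -- SDC for `D'`
  obtain ⟨c, δ₀, hc, hδ₀, hconf⟩ := h D' a b hab (2 * R) r hL' hr hd8'
  -- nesting thresholds
  obtain ⟨δ₁, hδ₁, hn₁⟩ := exists_meshDomain_subset_socket D hL hr hd8
  obtain ⟨δ₂, hδ₂, hn₂⟩ :=
    D'.toJordanDomain.exists_forall_meshDomain_subset D.toJordanDomain hsub
  -- the two socketed discs coincide
  have hsock' : D.carrier ∩ (closedBall (D.pt 0) r ∪ closedBall (D.pt 1) r) ⊆ D'.carrier := by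
    refine fun z hz => hsock ⟨hz.1, ?_⟩
    rcases hz.2 with hz0 | hz1
    · exact Or.inl (mem_ball.2 ((mem_closedBall.1 hz0).trans_lt hrd))
    · exact Or.inr (mem_ball.2 ((mem_closedBall.1 hz1).trans_lt hrd))
  have hΩ := standardPair_socketedDisc_eq (L := 2 * R) hsub hDL hsock'
  rw [hΩ] at hn₁
  rw [← h0, ← h1] at hn₁ hΩ
  have hDΩ : D.carrier ⊆ D'.carrier ∪ (ball (0 : ℂ) (2 * R) \
      (closedBall (D'.pt 0) r ∪ closedBall (D'.pt 1) r)) := by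
    rw [← hΩ]
    exact subset_union_left
  refine ⟨c, min δ₀ (min δ₁ δ₂), hc, lt_min hδ₀ (lt_min hδ₁ hδ₂), fun δ hδ => ?_⟩
  have hδ0 : δ ∈ Set.Ioc (0 : ℝ) δ₀ := ⟨hδ.1, hδ.2.trans (min_le_left _ _)⟩
  have hδ1 : δ ≤ δ₁ := hδ.2.trans ((min_le_right _ _).trans (min_le_left _ _))
  have hδ2 : δ ≤ δ₂ := hδ.2.trans ((min_le_right _ _).trans (min_le_right _ _))
  -- nesting of the walks at mesh `δ`
  have hN₁₃ : ∀ γ' : SAW.DomainSAW D'.carrier δ (a δ) (b δ),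
      ∃ γ : SAW.DomainSAW D.carrier δ (a δ) (b δ), γ.walk.support = γ'.walk.support :=
    fun γ' => exists_domainSAW_of_meshDomain_subset hsub (hn₂ δ hδ.1 hδ2) γ'
  have hN₃₄ : ∀ γ' : SAW.DomainSAW D.carrier δ (a δ) (b δ),
      ∃ γ : SAW.DomainSAW (D'.carrier ∪ (ball (0 : ℂ) (2 * R) \
        (closedBall (D'.pt 0) r ∪ closedBall (D'.pt 1) r))) δ (a δ) (b δ),
        γ.walk.support = γ'.walk.support :=
    fun γ' => exists_domainSAW_of_meshDomain_subset hDΩ (hn₁ δ hδ.1 hδ1) γ'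
  exact (hconf δ hδ0).trans (ConfinementMono.law_setOf_exists_support_eq_anti hN₁₃ hN₃₄)

/-! ### The registered stub T2 = T2a ∘ T2b -/

/-- **Stub T2 `stub_standardPairReduction`** (registered signature, verbatim): the standard-pair
statement SPC implies the body of the crux `SAWRenewalTightness.ConfinementPositivity`, by the outer
standardisation `T2a ∘ T2b` (socketed disc, socket nesting, antitonicity of the confinement probability
in the outer domain). [folklore] -/
theorem stub_standardPairReduction :
    (∀ (D : DobrushinDomain) (a b : ℝ → Site 2), SAW.IsEndpointApprox D a b →
      ∀ (L r : ℝ), closure D.carrier ⊆ Metric.ball (0 : ℂ) (L / 2) → 0 < r →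
        8 * r ≤ dist (D.pt 0) (D.pt 1) →
        ∃ (B : Finset (ℂ × ℂ)) (c δ₀ : ℝ), (∀ p ∈ B, Complex.Rectangle p.1 p.2 ⊆ D.carrier) ∧
          0 < c ∧ 0 < δ₀ ∧ ∀ δ ∈ Set.Ioc (0 : ℝ) δ₀,
          ENNReal.ofReal c ≤
            SAW.law (D.carrier ∪ (Metric.ball (0 : ℂ) L \
                (Metric.closedBall (D.pt 0) r ∪ Metric.closedBall (D.pt 1) r))) δ (a δ) (b δ)
              {γ | ∃ γ' : SAW.DomainSAW D.carrier δ (a δ) (b δ),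
                γ'.walk.support = γ.walk.support ∧
                ∀ v ∈ γ'.walk.support,
                  meshPoint δ v ∈ Metric.ball (D.pt 0) (2 * r) ∪ Metric.ball (D.pt 1) (2 * r) ∨
                  ∃ p ∈ B, meshPoint δ v ∈ Complex.Rectangle p.1 p.2}) →
    (∀ (D D' : DobrushinDomain) (a b : ℝ → Site 2) (d : ℝ), 0 < d → D'.carrier ⊆ D.carrier →
      D'.pt 0 = D.pt 0 → D'.pt 1 = D.pt 1 →
      D.carrier ∩ (Metric.ball (D.pt 0) d ∪ Metric.ball (D.pt 1) d) ⊆ D'.carrier →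
      SAW.IsEndpointApprox D' a b → ∃ c δ₀ : ℝ, 0 < c ∧ 0 < δ₀ ∧ ∀ δ ∈ Set.Ioc (0 : ℝ) δ₀,
        ENNReal.ofReal c ≤ SAW.law D.carrier δ (a δ) (b δ)
          {γ | ∃ γ' : SAW.DomainSAW D'.carrier δ (a δ) (b δ), γ'.walk.support = γ.walk.support}) := by
  intro h
  exact standardPair_confinementPositivity_of_socketedDisc (standardPair_socketedDisc_of_standardPair h)

end Summit.CriticalPhenomena.SAWScalingLimit.Theorems

end
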